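import Summits.Ventures.HodgeRepro.Tier3PadicCharacters

/-!
# Tier 3, T3.2 — the pinning chain on the ring the route actually uses: `𝓞_ℂ_[p]` (seat t3-p3, gen 2)

Blind re-derivation cell `pub-hodge-repro`, Tier-3 seat `t3-p3` (route/TIER3.md v1.1 §3 row R-B, sub-residual
R-B.3).  `Tier3PadicCharacters` states the ν ↔ ζ dictionary and the pinning chain for an abstract complete
ultrametric normed `ℤ_p`-algebra `B` with a linear topology in which `p` is a non-zero, non-unit, topologically
nilpotent element.  The route's `B` is the ring of integers `O_{ℂ_p}` of the `p`-adic complex numbers, which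
Mathlib provides as `𝓞_ℂ_[p]` (`PadicComplexInt p`, the valuation subring of `ℂ_[p]`).  This file supplies the
instances and facts that `𝓞_ℂ_[p]` is such a `B`:

* `mem_padicComplexInt_iff` — `x ∈ 𝓞_ℂ_[p] ↔ ‖x‖ ≤ 1` (the norm of `ℂ_[p]` is its valuation);
* `padicIntToComplexInt` / the `Algebra ℤ_[p] 𝓞_ℂ_[p]` instance — `ℤ_[p] → ℚ_[p] → ℂ_[p]` lands in the unit ball;
  `IsBoundedSMul ℤ_[p] 𝓞_ℂ_[p]` (the norm is multiplicative);
* `CompleteSpace 𝓞_ℂ_[p]` (the unit ball is closed in the complete field `ℂ_[p]`);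
* `IsLinearTopology 𝓞_ℂ_[p] 𝓞_ℂ_[p]` — the open balls `{‖x‖ < r}` are ideals of `𝓞_ℂ_[p]` (ultrametric,
  `‖a x‖ = ‖a‖ ‖x‖ ≤ ‖x‖`) and form a basis of neighbourhoods of `0`;
* `p` in `𝓞_ℂ_[p]` is non-zero, not a unit (`‖p‖ = p⁻¹ < 1`) and topologically nilpotent;
* `four_line_pinning_padicComplexInt` — `four_line_pinning_of_padic_chars` with `B := 𝓞_ℂ_[p]` and every
  `B`-side hypothesis discharged: the four lines over the continuous characters of `ℤ_p` with values in
  `𝓞_ℂ_[p]`, the common character, N2.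

HONESTY.  `hL` (the interpolation formula), `h0` (one non-vanishing value per line — TIER3.md's residual R-B)
and `hε` (sign cofiniteness) remain hypotheses; nothing about Hecke characters or `L`-values is proved.
Nothing here says anything about the status of the Hodge conjecture for CM abelian varieties, which is NOT proved.
-/

set_option autoImplicit false

open scoped NNReal
open MonoidWithZeroHom.ValueGroup₀ Filter Topology

namespace Summit.Ventures.HodgeRepro.T3.R2Pinning

variable (p : ℕ) [Fact p.Prime]

section Basics

/-- On `ℂ_[p]` the norm is the valuation, read in `ℝ`. -/
theorem PadicComplex.norm_eq_coe_valuation (x : ℂ_[p]) : ‖x‖ = ((Valued.v x : ℝ≥0) : ℝ) := by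
  rw [PadicComplex.norm_eq_norm, Valuation.norm_def, PadicComplex.RankOne.hom_eq_embedding,
    Valuation.embedding_restrict]

/-- Membership in `𝓞_ℂ_[p]` is `‖x‖ ≤ 1`. -/
theorem mem_padicComplexInt_iff (x : ℂ_[p]) : x ∈ 𝓞_ℂ_[p] ↔ ‖x‖ ≤ 1 := by
  rw [PadicComplexInt, Valuation.mem_valuationSubring_iff, PadicComplex.norm_eq_coe_valuation]
  exact_mod_cast Iff.rfl

/-- The norm of `𝓞_ℂ_[p]` is the norm of `ℂ_[p]`. -/
theorem norm_padicComplexInt (x : 𝓞_ℂ_[p]) : ‖x‖ = ‖(x : ℂ_[p])‖ := rfl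

/-- The ring homomorphism `ℤ_[p] → ℂ_[p]` (through `ℚ_[p]`) has image in the unit ball. -/
theorem norm_algebraMap_padicInt_le_one (x : ℤ_[p]) :
    ‖algebraMap ℚ_[p] ℂ_[p] (algebraMap ℤ_[p] ℚ_[p] x)‖ ≤ 1 := by
  have h1 : ‖algebraMap ℚ_[p] ℂ_[p] (algebraMap ℤ_[p] ℚ_[p] x)‖ = ‖algebraMap ℤ_[p] ℚ_[p] x‖ :=
    norm_algebraMap' ℂ_[p] _
  rw [h1]
  exact PadicInt.norm_le_one x

end Basics

section Algebra

/-- The ring homomorphism `ℤ_[p] → 𝓞_ℂ_[p]`, the restriction of `ℤ_[p] → ℚ_[p] → ℂ_[p]` to the unit ball. -/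
noncomputable def padicIntToComplexInt : ℤ_[p] →+* 𝓞_ℂ_[p] :=
  ((algebraMap ℚ_[p] ℂ_[p]).comp (algebraMap ℤ_[p] ℚ_[p])).codRestrict (𝓞_ℂ_[p]).toSubring fun x =>
    (mem_padicComplexInt_iff p _).2 (norm_algebraMap_padicInt_le_one p x)

/-- The underlying element of `ℂ_[p]` of `padicIntToComplexInt p x`. -/
@[simp]
theorem coe_padicIntToComplexInt (x : ℤ_[p]) :
    ((padicIntToComplexInt p x : 𝓞_ℂ_[p]) : ℂ_[p]) = algebraMap ℚ_[p] ℂ_[p] (algebraMap ℤ_[p] ℚ_[p] x) :=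
  rfl

/-- `𝓞_ℂ_[p]` is a `ℤ_[p]`-algebra. -/
noncomputable instance : Algebra ℤ_[p] 𝓞_ℂ_[p] := (padicIntToComplexInt p).toAlgebra

/-- The algebra map `ℤ_[p] → 𝓞_ℂ_[p]` is `padicIntToComplexInt`. -/
theorem algebraMap_padicInt_apply (x : ℤ_[p]) :
    algebraMap ℤ_[p] 𝓞_ℂ_[p] x = padicIntToComplexInt p x := rfl

/-- The algebra map `ℤ_[p] → 𝓞_ℂ_[p]` is an isometry. -/
theorem norm_algebraMap_padicInt (x : ℤ_[p]) : ‖algebraMap ℤ_[p] 𝓞_ℂ_[p] x‖ = ‖x‖ := by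
  rw [algebraMap_padicInt_apply, norm_padicComplexInt, coe_padicIntToComplexInt,
    norm_algebraMap' ℂ_[p] _]
  rfl

/-- The `ℤ_[p]`-action on `𝓞_ℂ_[p]` is bounded: `‖a • x‖ ≤ ‖a‖ ‖x‖`. -/
instance : IsBoundedSMul ℤ_[p] 𝓞_ℂ_[p] :=
  IsBoundedSMul.of_norm_smul_le fun a x => by
    rw [Algebra.smul_def, ← norm_algebraMap_padicInt p a]
    exact norm_mul_le _ _

/-- `𝓞_ℂ_[p]` is complete: the unit ball is closed in the complete field `ℂ_[p]`. -/
instance : CompleteSpace 𝓞_ℂ_[p] :=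
  haveI : IsClosed ((𝓞_ℂ_[p] : ValuationSubring ℂ_[p]) : Set ℂ_[p]) :=
    Valued.isClosed_valuationSubring ℂ_[p]
  IsClosed.completeSpace_coe

end Algebra

section LinearTopology

/-- The open ball of radius `r > 0` about `0` in `𝓞_ℂ_[p]` is an ideal (ultrametric inequality, and
`‖a x‖ ≤ ‖a‖ ‖x‖ ≤ ‖x‖` for `‖a‖ ≤ 1`). -/
noncomputable def ballIdeal (r : ℝ) (hr : 0 < r) : Ideal 𝓞_ℂ_[p] where
  carrier := Metric.ball (0 : 𝓞_ℂ_[p]) r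
  add_mem' {x y} hx hy := by
    rw [mem_ball_zero_iff] at hx hy ⊢
    exact (IsUltrametricDist.norm_add_le_max x y).trans_lt (max_lt hx hy)
  zero_mem' := by
    rw [mem_ball_zero_iff, norm_zero]
    exact hr
  smul_mem' a {x} hx := by
    rw [mem_ball_zero_iff] at hx ⊢
    rw [smul_eq_mul]
    calc ‖a * x‖ ≤ ‖a‖ * ‖x‖ := norm_mul_le a x
      _ ≤ 1 * ‖x‖ := by
          gcongr
          exact (mem_padicComplexInt_iff p (a : ℂ_[p])).1 a.2
      _ = ‖x‖ := one_mul _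
      _ < r := hx

/-- The underlying set of `ballIdeal p r hr` is the open ball of radius `r` about `0`. -/
theorem coe_ballIdeal (r : ℝ) (hr : 0 < r) : (ballIdeal p r hr : Set 𝓞_ℂ_[p]) = Metric.ball 0 r := rfl

/-- `𝓞_ℂ_[p]` is linearly topologised: the ideals `ballIdeal r`, `r > 0`, form a basis of
neighbourhoods of `0`. -/
instance : IsLinearTopology 𝓞_ℂ_[p] 𝓞_ℂ_[p] := by
  let s : ℝ → Ideal 𝓞_ℂ_[p] := fun r => if hr : 0 < r then ballIdeal p r hr else ⊤
  have hs : ∀ r : ℝ, 0 < r → (s r : Set 𝓞_ℂ_[p]) = Metric.ball 0 r := fun r hr => by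
    simp only [s, dif_pos hr, coe_ballIdeal]
  refine IsLinearTopology.mk_of_hasBasis' 𝓞_ℂ_[p] (S := Ideal 𝓞_ℂ_[p]) (p := fun r : ℝ => 0 < r)
    (s := s) ?_ (fun I a m hm => I.smul_mem a hm)
  exact (Metric.nhds_basis_ball (x := (0 : 𝓞_ℂ_[p]))).congr (fun _ => Iff.rfl)
    (fun r hr => (hs r hr).symm)

end LinearTopology

section PrimeFacts

/-- `‖p‖ = p⁻¹` in `𝓞_ℂ_[p]`. -/
theorem norm_natCast_prime : ‖((p : ℕ) : 𝓞_ℂ_[p])‖ = (p : ℝ)⁻¹ := by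
  rw [norm_padicComplexInt, Subring.coe_natCast, ← map_natCast (algebraMap ℚ_[p] ℂ_[p]),
    norm_algebraMap' ℂ_[p] _, Padic.norm_p]

/-- `‖p‖ < 1` in `𝓞_ℂ_[p]`. -/
theorem norm_natCast_prime_lt_one : ‖((p : ℕ) : 𝓞_ℂ_[p])‖ < 1 := by
  rw [norm_natCast_prime]
  have hp : 1 < (p : ℝ) := by exact_mod_cast (Fact.out : p.Prime).one_lt
  exact inv_lt_one_of_one_lt₀ hp

/-- `p ≠ 0` in `𝓞_ℂ_[p]`. -/
theorem natCast_prime_ne_zero : ((p : ℕ) : 𝓞_ℂ_[p]) ≠ 0 := by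
  intro h
  have := congrArg norm h
  rw [norm_natCast_prime, norm_zero] at this
  have hp : (0 : ℝ) < p := by exact_mod_cast (Fact.out : p.Prime).pos
  exact (inv_pos.2 hp).ne' this

/-- `p` is not a unit of `𝓞_ℂ_[p]`: a unit has norm `1`, while `‖p‖ = p⁻¹ < 1`. -/
theorem not_isUnit_natCast_prime : ¬ IsUnit ((p : ℕ) : 𝓞_ℂ_[p]) := by
  rintro ⟨u, hu⟩
  set v : 𝓞_ℂ_[p] := ((u⁻¹ : 𝓞_ℂ_[p]ˣ) : 𝓞_ℂ_[p]) with hv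
  have huv : (u : 𝓞_ℂ_[p]) * v = 1 := u.mul_inv
  have h1 : (1 : ℝ) ≤ ‖(u : 𝓞_ℂ_[p])‖ * ‖v‖ := by
    calc (1 : ℝ) = ‖((u : 𝓞_ℂ_[p]) * v)‖ := by rw [huv, norm_one]
      _ ≤ ‖(u : 𝓞_ℂ_[p])‖ * ‖v‖ := norm_mul_le _ _
  have h2 : ‖v‖ ≤ 1 := (mem_padicComplexInt_iff p (v : ℂ_[p])).1 v.2
  have h3 : ‖(u : 𝓞_ℂ_[p])‖ < 1 := by rw [hu]; exact norm_natCast_prime_lt_one p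
  have h4 : ‖(u : 𝓞_ℂ_[p])‖ * ‖v‖ < 1 := by
    calc ‖(u : 𝓞_ℂ_[p])‖ * ‖v‖ ≤ ‖(u : 𝓞_ℂ_[p])‖ * 1 := by gcongr
      _ < 1 := by rw [mul_one]; exact h3
  linarith

/-- `p` is topologically nilpotent in `𝓞_ℂ_[p]`: `‖p^n‖ ≤ ‖p‖^n = p^{-n} → 0`. -/
theorem isTopologicallyNilpotent_natCast_prime : IsTopologicallyNilpotent ((p : ℕ) : 𝓞_ℂ_[p]) := by
  have hlt := norm_natCast_prime_lt_one p
  have h0 : (0 : ℝ) ≤ ‖((p : ℕ) : 𝓞_ℂ_[p])‖ := norm_nonneg _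
  have hpow : Tendsto (fun n : ℕ => ‖((p : ℕ) : 𝓞_ℂ_[p])‖ ^ n) atTop (𝓝 0) :=
    tendsto_pow_atTop_nhds_zero_of_lt_one h0 hlt
  rw [IsTopologicallyNilpotent, tendsto_zero_iff_norm_tendsto_zero]
  refine squeeze_zero (fun n => norm_nonneg _) (fun n => norm_pow_le ((p : ℕ) : 𝓞_ℂ_[p]) n) hpow

end PrimeFacts

section Instantiation

open PowerSeries

variable {A : Type*} [CommRing A] [IsDomain A] [IsDiscreteValuationRing A]
  [IsAdicComplete (IsLocalRing.maximalIdeal A) A] [UniformSpace A] [IsUniformAddGroup A]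
  [IsTopologicalRing A] [Algebra A 𝓞_ℂ_[p]] [ContinuousSMul A 𝓞_ℂ_[p]]

/-- **The face on `𝓞_ℂ_[p]`.** `four_line_pinning_of_padic_chars` with `B := 𝓞_ℂ_[p]`: every hypothesis on
the coefficient ring is discharged; what remains are the line data — the branch elements `G j ∈ A⟦X⟧` (`A` the
complete DVR of coefficients, mapped injectively into `𝓞_ℂ_[p]`), the interpolation formula at `κ 1 − 1`
(`hL`), ONE non-vanishing value per line (`h0` = TIER3.md's R-B) and sign cofiniteness (`hε`). -/
theorem four_line_pinning_padicComplexInt (hinj : Function.Injective (algebraMap A 𝓞_ℂ_[p]))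
    (G : Fin 4 → PowerSeries A) (L u : Fin 4 → {κ : AddChar ℤ_[p] 𝓞_ℂ_[p] // Continuous κ} → 𝓞_ℂ_[p])
    (hu : ∀ j κ, u j κ ≠ 0)
    (hL : ∀ j κ, L j κ = u j κ * aeval (hasEval_eval_one_sub_one κ) (G j))
    (h0 : ∀ j, ∃ κ₀, L j κ₀ ≠ 0) (ε : Fin 4 → {κ : AddChar ℤ_[p] 𝓞_ℂ_[p] // Continuous κ} → ℤˣ)
    (hε : ∀ j, {κ | ε j κ ≠ 1}.Finite) :
    {κ : {κ : AddChar ℤ_[p] 𝓞_ℂ_[p] // Continuous κ} | ∀ j, L j κ ≠ 0 ∧ ε j κ = 1}.Infinite ∧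
      ∀ κ ∈ {κ : {κ : AddChar ℤ_[p] 𝓞_ℂ_[p] // Continuous κ} | ∀ j, L j κ ≠ 0 ∧ ε j κ = 1},
        ∀ η : Fin 4 → {κ : AddChar ℤ_[p] 𝓞_ℂ_[p] // Continuous κ}, (∀ j, η j = κ) →
          (η 0).1 * (η 1).1 = (η 2).1 * (η 3).1 :=
  four_line_pinning_of_padic_chars hinj (natCast_prime_ne_zero p) (not_isUnit_natCast_prime p)
    (isTopologicallyNilpotent_natCast_prime p) G L u hu hL h0 ε hε

end Instantiation

end Summit.Ventures.HodgeRepro.T3.R2Pinning
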